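import Summits.KontsevichZagierPeriods.KontsevichZagierPeriods.Theses.IsogenyCertificates
import Literature.NumberTheory.Transcendental.KZKernelConjectureForms

/-!
# `GenusTwoRealPeriodCell` (stmt-KontsevichZagierPeriods-17657, route IsogenyCertificates) — negative knowledge, part 1: strength and shape

Support file of the standing disprover of the crux `GenusTwoRealPeriodCell` (work file
`Cruxes/GenusTwoRealPeriodCell/Disproof.lean`). The crux is Conjecture 1 of Kontsevich–Zagier in
KERNEL FORM on the sector of real half-periods of genus-2 curves over `ℚ`: every value-`0` element of
the subgroup generated by the representations `[K, (a₀+a₁x)/√F]` (`F ∈ ℚ[x]` squarefree of degree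
5 or 6, `K` the component of `{F>0}` through a rational point `q`, `a₀ a₁ ∈ ℚ`) lies in
`KZ.relations`. Nothing here refutes it. Importable, sorry-free findings (theorems only; `genSet`
is a local notation for the literal generating set of the crux, so every statement displays it):

* §1 STRENGTH. The crux is a corollary of the summit (`not_summit_of_not`, via the tree's
  `kzKernelConjecture_iff_isRational`), and so is EVERY sector cell whatever the sector
  (`not_summit_of_not_sectorCell`): none of the sector-shaping hypotheses (`Squarefree`, degree
  `5/6`, `F(q) > 0`, rationality of `q, a₀, a₁`) is load-bearing for TRUTH — dropping any of them
  gives another corollary of the summit; they shape the METHOD only. A refutation of the crux is a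
  refutation of the formalised Kontsevich–Zagier conjecture; no `refuted-misstated` outcome exists.
* §2 SHAPE OF ANY REFUTATION: an additive invariant of `KZ.FormalRep` killing the four move sets but
  not some value-`0` element of the sector (`not_of_separating_invariant`, complete by
  `exists_separating_invariant_of_not`).
* §3 MONOTONICITY: the sibling crux `BiellipticRealPeriodCell` (stmt-18685) is the sub-cell
  `F = G(x²)`; a refutation of it refutes this crux (`not_of_not_bielliptic`).

Part 2 (`Negative/Witnesses.lean`) has the honest witnesses on `y² = x⁶ + 1`, the parity law, the
failure of generator non-degeneracy and the sub-calculus analysis.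

Sources: M. Kontsevich, D. Zagier, *Periods* (2001), §1.2 (rules, Conjecture 1);
A. Huber, G. Wüstholz, *Transcendence and linear relations of 1-periods* (2022), Thm 13.3 (the
transcendence input of the sector, not used here).
-/

noncomputable section

namespace Summit.KontsevichZagierPeriods.GenusTwoRealPeriodCell.Negative

open Literature.NumberTheory.Transcendental
open Summit.KontsevichZagierPeriods.KontsevichZagierPeriods.Theses.IsogenyCertificates
open Set Polynomial
/-! ### §0 Vocabulary -/

-- The generating set of the genus-two sector, literally as in the crux (a local NOTATION, so that
-- this file declares theorems only and every statement displays the literal set): `[r]` for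
-- `r = [component of {F>0} through q, (a₀+a₁x)/√F]`, `F` squarefree of degree 5 or 6, `F(q) > 0`.
set_option quotPrecheck false in
local notation "genSet" =>
  ({d | ∃ (F : Polynomial ℚ) (q a₀ a₁ : ℚ) (r : KZ.IntegralRep 1),
    Squarefree F ∧ (F.natDegree = 5 ∨ F.natDegree = 6) ∧ 0 < Polynomial.aeval (q : ℝ) F ∧
    r.domain = {x | x 0 ∈ connectedComponentIn {y : ℝ | 0 < Polynomial.aeval y F} (q : ℝ)} ∧
    Set.EqOn r.integrand
      (fun x => ((a₀ : ℝ) + (a₁ : ℝ) * x 0) / Real.sqrt (Polynomial.aeval (x 0) F)) r.domain ∧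
    d = KZ.of r} : Set KZ.FormalRep)

/-- The crux, unfolded (definitional). [folklore] -/
theorem cell_iff :
    GenusTwoRealPeriodCell ↔
      ∀ c ∈ AddSubgroup.closure genSet, KZ.eval c = 0 → c ∈ KZ.relations := Iff.rfl

/-! ### §1 Strength: the crux, and every sector cell, is a corollary of the summit -/

/-- **Kernel conjecture ⇒ any sector cell**, contrapositively: a sector cell that fails refutes the
kernel form of Conjecture 1, WHATEVER the generating set `T`. In particular no hypothesis that only
shapes the sector (`Squarefree F`, `natDegree F ∈ {5,6}`, `0 < F(q)`, `q a₀ a₁ ∈ ℚ`) is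
load-bearing for truth. [cite: KontsevichZagier2001, §1.2 Conjecture 1] -/
theorem not_kzKernelConjecture_of_not_sectorCell {T : Set KZ.FormalRep}
    (h : ¬ ∀ c ∈ AddSubgroup.closure T, KZ.eval c = 0 → c ∈ KZ.relations) :
    ¬ KZKernelConjecture := fun hK =>
  h fun c _ hc => hK c hc

/-- … hence refutes the summit (tree: `kzKernelConjecture_iff_isRational`).
[cite: KontsevichZagier2001, §1.2 Conjecture 1] -/
theorem not_summit_of_not_sectorCell {T : Set KZ.FormalRep}
    (h : ¬ ∀ c ∈ AddSubgroup.closure T, KZ.eval c = 0 → c ∈ KZ.relations) :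
    ¬ _root_.KontsevichZagierPeriods := fun hs =>
  not_kzKernelConjecture_of_not_sectorCell h
    ((KontsevichZagierPeriods_iff.trans kzKernelConjecture_iff_isRational.symm).1 hs)

/-- **The summit implies the crux** (contrapositive form): a refutation of `GenusTwoRealPeriodCell`
is literally a refutation of the formalised period conjecture. [cite: KontsevichZagier2001, §1.2 Conjecture 1] -/
theorem not_summit_of_not (h : ¬ GenusTwoRealPeriodCell) : ¬ _root_.KontsevichZagierPeriods :=
  not_summit_of_not_sectorCell (T := genSet) h

/-- The same one level down: `¬ crux → ¬ KZKernelConjecture`. [cite: KontsevichZagier2001, §1.2 Conjecture 1] -/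
theorem not_kzKernelConjecture_of_not (h : ¬ GenusTwoRealPeriodCell) : ¬ KZKernelConjecture :=
  not_kzKernelConjecture_of_not_sectorCell (T := genSet) h

/-! ### §2 The shape of any refutation -/

/-- `¬ crux` unfolded: a value-`0` element of the sector outside `KZ.relations`. [folklore] -/
theorem not_iff :
    ¬ GenusTwoRealPeriodCell ↔
      ∃ c ∈ AddSubgroup.closure genSet, KZ.eval c = 0 ∧ c ∉ KZ.relations := by
  rw [cell_iff]
  push Not
  rfl

/-- **Separating-invariant template.** An additive invariant that kills the four move sets but not
some value-`0` element of the sector refutes the crux (and hence the summit). [folklore] -/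
theorem not_of_separating_invariant {G : Type*} [AddCommGroup G] (ψ : KZ.FormalRep →+ G)
    (hψ : KZ.domainAddRel ∪ KZ.integrandAddRel ∪ KZ.changeOfVariablesRel ∪ KZ.newtonLeibnizRel ⊆
      (ψ.ker : Set KZ.FormalRep))
    {c : KZ.FormalRep} (hc : c ∈ AddSubgroup.closure genSet) (h0 : KZ.eval c = 0) (hψc : ψ c ≠ 0) :
    ¬ GenusTwoRealPeriodCell := fun h =>
  hψc ((AddSubgroup.closure_le _).2 hψ (h c hc h0))

/-- The template is complete: from any counterexample the quotient map by `KZ.relations` is a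
separating invariant. [folklore] -/
theorem exists_separating_invariant_of_not (h : ¬ GenusTwoRealPeriodCell) :
    ∃ (ψ : KZ.FormalRep →+ KZ.FormalRep ⧸ KZ.relations) (c : KZ.FormalRep),
      KZ.domainAddRel ∪ KZ.integrandAddRel ∪ KZ.changeOfVariablesRel ∪ KZ.newtonLeibnizRel ⊆
        (ψ.ker : Set KZ.FormalRep) ∧
      c ∈ AddSubgroup.closure genSet ∧ KZ.eval c = 0 ∧ ψ c ≠ 0 := by
  obtain ⟨c, hc, h0, hcn⟩ := not_iff.1 h
  refine ⟨QuotientAddGroup.mk' _, c, fun d hd => ?_, hc, h0, ?_⟩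
  · rw [SetLike.mem_coe, QuotientAddGroup.ker_mk']
    exact AddSubgroup.subset_closure hd
  · rwa [Ne, QuotientAddGroup.mk'_apply, QuotientAddGroup.eq_zero_iff]

/-! ### §3 Monotonicity: the bielliptic sub-cell -/

/-- The generators of the sibling crux `BiellipticRealPeriodCell` (`F = G(x²)`, `G` a cubic,
bounded components) are generators of this sector: `G.comp (X^2)` is squarefree (given) of degree
`3·2 = 6`; boundedness is simply forgotten. [folklore] -/
theorem biellipticGen_subset_genSet :
    {d : KZ.FormalRep | ∃ (G : Polynomial ℚ) (q a₀ a₁ : ℚ) (r : KZ.IntegralRep 1), G.natDegree = 3 ∧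
      Squarefree (G.comp (Polynomial.X ^ 2)) ∧
      0 < Polynomial.aeval (q : ℝ) (G.comp (Polynomial.X ^ 2)) ∧
      Bornology.IsBounded
        (connectedComponentIn {y : ℝ | 0 < Polynomial.aeval y (G.comp (Polynomial.X ^ 2))} (q : ℝ)) ∧
      r.domain = {x | x 0 ∈
        connectedComponentIn {y : ℝ | 0 < Polynomial.aeval y (G.comp (Polynomial.X ^ 2))} (q : ℝ)} ∧
      Set.EqOn r.integrand (fun x => ((a₀ : ℝ) + (a₁ : ℝ) * x 0) /
        Real.sqrt (Polynomial.aeval (x 0) (G.comp (Polynomial.X ^ 2)))) r.domain ∧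
      d = KZ.of r} ⊆ genSet := by
  rintro d ⟨G, q, a₀, a₁, r, hdeg, hsq, hpos, -, hdom, hint, rfl⟩
  refine ⟨G.comp (X ^ 2), q, a₀, a₁, r, hsq, Or.inr ?_, hpos, hdom, hint, rfl⟩
  rw [Polynomial.natDegree_comp, hdeg, Polynomial.natDegree_X_pow]

/-- **`GenusTwoRealPeriodCell → BiellipticRealPeriodCell`**, contrapositively: a refutation of the
bielliptic sub-cell (stmt-18685) refutes this crux. [folklore] -/
theorem not_of_not_bielliptic (h : ¬ BiellipticRealPeriodCell) : ¬ GenusTwoRealPeriodCell :=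
  fun hG => h fun c hc h0 => hG c (AddSubgroup.closure_mono biellipticGen_subset_genSet hc) h0

end Summit.KontsevichZagierPeriods.GenusTwoRealPeriodCell.Negative
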